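import Summits.ResolutionOfSingularities.ResolutionOfSingularities.Theorems.EquisingularLiftEquisingularLiftNatResidueHypDefsND
import Summits.ResolutionOfSingularities.ResolutionOfSingularities.Theorems.EquisingularLiftEquisingularLiftNatNDChartPlays
import Summits.ResolutionOfSingularities.ResolutionOfSingularities.Theorems.EquisingularLiftEquisingularLiftNatModelStepChain
import Literature.AlgebraicGeometry.Resolution.MarkedIdeals
import Literature.AlgebraicGeometry.Resolution.StrictTransformDistinct
import Literature.AlgebraicGeometry.Resolution.BlowupsExistence
import HarnessLib

/-!
# [OURS · L1 W4.5(b) · EL♮(3)] PORT DRAFT for the text owner — the SORRY-FREE part (D) of the ND ENGINE SPEC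
# `Cruxes/EquisingularLiftNatThree/NewtonNondegenerateRungK5.lean` v4 (§13.1 strata towers / `ReachToric` · §13.5 small print · §13.6 the O-side iteration PROVED ·
# §13.7 the candidate upstairs invariant `SNCInv` (definition only) · §13.9 the k-side iteration PROVED · §13.10 the candidate downstairs invariant `NDInv` + (B4-end))

OURS · L1 W4.5(b) · EL♮(3) stmt-ResolutionOfSingularities-20148 · counted 0 · AI-written (res-L1-w45b-idea-1 g23), weaker than expert review; nothing of [Hironaka2017]
asserted; NOT a statement of the manuscript.  Sorry-free, standard axioms, no instance, no notation.  Intended tree home (text owner's choice): namespace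
`…Cruxes.EquisingularLiftNat.Sections.ND`, split by the 400-line rule at the `-- ===== FILE` markers below into
`…NatNDStrataTower` (§13.1 + §13.5) → `…NatNDStrataLift` (§13.6 + §13.7 def) and `…NatNDRounds` (§13.9 + §13.10 + §13.12 statements/composition), each `--supports stmt-ResolutionOfSingularities-20148 --as helper`.
Once ported, the five clause-bricks of the spec — (B3a) `sncInv_init`, (B3g) `sncInv_stratumFacts`, (B3b) `sncInv_stepFacts`, (B4-init) `ndInv_init`, (B4α′) `roundAtNDFrame`,
(B4β′) `ndInvPersists` — and the derived (B4-round) `ndInv_round`, (B3) `hsub_strataLift`, (B4) `hres_toricRounds`, `nd_rung_local_K5`, `ndStubWonK5_holds` close BY NAME against these definitions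
(ENGINE WORD §6).  Bodies VERBATIM from the spec.  `lean check`: rc 0 · 0 errors · 0 warnings · 0 sorries; `#print axioms` of `strataTower_lift` /
`hsub_strataLift_of_invariant` / `rounds_resolve` / `hres_of_rounds` / `ndInv_end` standard.  The advisory audit class `vendored-fact` on the Prop-valued PREDICATES
(`IsFrameAt`, `ReachToric`, `StageTuple`, `StratumFacts`, `StepFacts`, `SNCInv`, `RoundClosed`, `RoundFacts`, `IsNDFrameAt`, `NDInv`, the inductive `StrataTower`) is the
same as for `…NatResidueHypDefsND`'s `IsoHypNDWon`: OUR parametrised definitions, not cited facts; `orphan` disappears once the bricks cite them.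
-/

set_option linter.dupNamespace false
set_option linter.overlappingInstances false
noncomputable section
open CategoryTheory CategoryTheory.Limits AlgebraicGeometry TopologicalSpace Topology
open MvPolynomial
open Literature.AlgebraicGeometry.Resolution
open AlgebraicGeometry.Scheme.IdealSheafData

namespace Summit.ResolutionOfSingularities.ResolutionOfSingularities.Cruxes.EquisingularLiftNat.Sections.ND

-- ===== FILE A: …NatNDStrataTower.lean (§13.1 + §13.5) =====

/-! ## 13.1 Boundaries indexed by rays, strata, strata towers, `ReachToric` -/

/-- A BOUNDARY on `F` indexed by rays of `ℤⁿ`: one ideal sheaf per ray (the value at a ray that is «not present» is `⊤`, the empty divisor).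
[OURS · L1 W4.5b · definition] -/
abbrev Boundary (n : ℕ) (F : Scheme.{0}) : Type := Ray n → F.IdealSheafData

variable {n : ℕ}

/-- The STRATUM (closed-orbit analogue) of a face `τ`: the sum of the ideals of its rays, `V(τ.sup E) = ⋂_{ρ ∈ τ} V(E ρ)`.  [OURS · definition] -/
def stratum {F : Scheme.{0}} (E : Boundary n F) (τ : Finset (Ray n)) : F.IdealSheafData := τ.sup E

/-- One step of the boundary: after blowing up `C` (by `υ`), the NEW ray `ν` carries the exceptional divisor `C·𝒪_{F'}`, every other ray the STRICT
transform of its divisor (Görtz–Wedhorn (13.19), `Literature…strictTransformIdeal`).  [OURS · definition] -/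
def Boundary.stepAlong {F F' : Scheme.{0}} (E : Boundary n F) (C : F.IdealSheafData) (ν : Ray n) (υ : F' ⟶ F) : Boundary n F' :=
  fun ρ => if ρ = ν then C.comap υ else strictTransformIdeal υ C (E ρ)

/-- The boundary of a FRAME `W = (W_1, …, W_n)`: the frame ray `e_j` carries `W_j`, every other ray `⊤`.  [OURS · definition] -/
def frameBoundary {F : Scheme.{0}} (W : Fin n → F.IdealSheafData) : Boundary n F :=
  fun ρ => (Finset.univ.filter (fun j => e n j = ρ)).inf W

/-- `W` is a FRAME AT `x`: the stalks `(W_j)_x` are principal, generated by a regular system of parameters `w_1, …, w_n` of the `n`-dimensional local ring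
`𝒪_{F,x}` (so `𝒪_{F,x}` is regular and `V(W_1), …, V(W_n)` are SNC divisors through `x` cutting out `x`).  Chart-free; the étale chart `(w_j) : Spec 𝒪_{F,x} → 𝔸ⁿ`
is DERIVED by the provers, not posited.  [OURS · definition] -/
def IsFrameAt {F : Scheme.{0}} (W : Fin n → F.IdealSheafData) (x : F) : Prop :=
  ∃ w : Fin n → F.presheaf.stalk x, (∀ j, stalkIdeal (W j) x = Ideal.span {w j}) ∧
    Ideal.span (Set.range w) = IsLocalRing.maximalIdeal (F.presheaf.stalk x) ∧
    ringKrullDim (F.presheaf.stalk x) = (n : WithBot ℕ∞)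

/-- **STRATA TOWERS.**  `StrataTower F E T F₉ β T₉`: `(F₉, β : F₉ ⟶ F, T₉)` is obtained from `(F, E, T)` by finitely many steps «choose a face `τ` with a NON-FRAME
ray whose stratum is E1-LEGAL for the current strict transform `T` (`supp ⊆ T`, `T ⊄ supp`), blow the stratum up, replace `E` by `E.stepAlong (stratum E τ) (Σ τ)`
and `T` by the strict transform `closure (υ⁻¹(T ∖ supp))`».  No fan, no equation: legality is carried as DATA (the k-side proves it from `Bad`, the O-side consumes
it).  [OURS · definition] -/
inductive StrataTower : ∀ (F : Scheme.{0}), Boundary n F → Set F → ∀ (F₉ : Scheme.{0}), (F₉ ⟶ F) → Set F₉ → Prop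
  | nil (F : Scheme.{0}) (E : Boundary n F) (T : Set F) : StrataTower F E T F (𝟙 F) T
  | cons (F : Scheme.{0}) (E : Boundary n F) (T : Set F) (τ : Finset (Ray n))
      (hτ : ∃ ρ ∈ τ, ρ ∉ Set.range (e n))
      (hE1 : ((stratum E τ).support : Set F) ⊆ T) (hT : ¬ T ⊆ ((stratum E τ).support : Set F))
      (F' : Scheme.{0}) (υ : F' ⟶ F) (hυ : IsBlowup υ (stratum E τ))
      (F₉ : Scheme.{0}) (β : F₉ ⟶ F') (T₉ : Set F₉) :
      StrataTower F' (E.stepAlong (stratum E τ) (∑ ρ ∈ τ, ρ) υ) (closure (υ ⁻¹' (T \ ((stratum E τ).support : Set F)))) F₉ β T₉ →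
      StrataTower F E T F₉ (β ≫ υ) T₉

/-- **`ReachToric n`** — the admissibility predicate fed to K5′ (`Reach` slot, same type): after the point blow-up `υ : F₂ ⟶ F₁` of the closed point `x`,
`(F₉, β, T₉)` is a STRATA TOWER over `(F₂, E₁, T₂)` where `E₁` = the frame boundary of some frame `W` at `x`, stepped along the point blow-up (the ray
`𝟙 = Σ_j e_j` carries the exceptional divisor `𝔪_x·𝒪_{F₂}`, the ray `e_j` the strict transform of `W_j`).  [OURS · definition] -/
def ReachToric (n : ℕ) : ∀ (F₁ F₂ : Scheme.{0}), (F₂ ⟶ F₁) → F₁ → Set F₂ → ∀ (F₉ : Scheme.{0}), (F₉ ⟶ F₂) → Set F₉ → Prop :=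
  fun F₁ F₂ υ x T₂ F₉ β T₉ => ∃ (hx : IsClosed ({x} : Set F₁)) (W : Fin n → F₁.IdealSheafData), IsFrameAt W x ∧
    StrataTower F₂ ((frameBoundary W).stepAlong (vanishingIdeal (⟨{x}, hx⟩ : Closeds F₁)) 1 υ) T₂ F₉ β T₉

/-! ## 13.5 Certified small print of the definitions -/

/-- The ray `𝟙 = (1, …, 1)` is the sum of the frame rays (the exceptional ray of the POINT blow-up = the star of the full orthant cone). [OURS] -/
theorem one_eq_sum_e : (1 : Ray n) = ∑ j : Fin n, e n j := by
  funext i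
  simp [e, Finset.sum_apply, Pi.single_apply]

/-- The frame boundary at a frame ray is the frame member. [OURS] -/
theorem frameBoundary_e {F : Scheme.{0}} (W : Fin n → F.IdealSheafData) (j : Fin n) : frameBoundary W (e n j) = W j := by
  have hinj : Function.Injective (e n) := fun a b h => by
    by_contra hab
    have := congrFun h a
    simp [e, hab] at this
  have : (Finset.univ.filter (fun i => e n i = e n j)) = {j} := by
    ext i; simp [hinj.eq_iff]
  simp [frameBoundary, this]

/-- The frame boundary at a non-frame ray is `⊤` (no divisor). [OURS] -/
theorem frameBoundary_of_not_mem_range {F : Scheme.{0}} (W : Fin n → F.IdealSheafData) {ρ : Ray n} (hρ : ρ ∉ Set.range (e n)) :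
    frameBoundary W ρ = ⊤ := by
  have : (Finset.univ.filter (fun i => e n i = ρ)) = ∅ := by
    ext i; simp only [Finset.mem_filter, Finset.mem_univ, true_and, Finset.notMem_empty, iff_false]
    exact fun h => hρ ⟨i, h⟩
  simp [frameBoundary, this]

/-- `stepAlong` at the new ray is the exceptional ideal, elsewhere the strict transform. [OURS] -/
theorem stepAlong_self {F F' : Scheme.{0}} (E : Boundary n F) (C : F.IdealSheafData) (ν : Ray n) (υ : F' ⟶ F) :
    E.stepAlong C ν υ ν = C.comap υ := by simp [Boundary.stepAlong]

theorem stepAlong_of_ne {F F' : Scheme.{0}} (E : Boundary n F) (C : F.IdealSheafData) {ν ρ : Ray n} (h : ρ ≠ ν) (υ : F' ⟶ F) :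
    E.stepAlong C ν υ ρ = strictTransformIdeal υ C (E ρ) := by simp [Boundary.stepAlong, h]

/-- A ray absent before a step (value `⊤`) and different from the new ray stays absent. [OURS; `strictTransformIdeal_top`] -/
theorem stepAlong_eq_top {F F' : Scheme.{0}} (E : Boundary n F) (C : F.IdealSheafData) {ν ρ : Ray n} (h : ρ ≠ ν) (υ : F' ⟶ F)
    (hρ : E ρ = ⊤) : E.stepAlong C ν υ ρ = ⊤ := by
  rw [stepAlong_of_ne E C h υ, hρ, strictTransformIdeal_top]

/-- The identity tower is admissible (zero steps). [OURS] -/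
theorem strataTower_nil {F : Scheme.{0}} (E : Boundary n F) (T : Set F) : StrataTower F E T F (𝟙 F) T := StrataTower.nil F E T



-- ===== FILE B: …NatNDStrataLift.lean (§13.6 + §13.7 definition) =====

/-! ## 13.6 (B3c) THE ITERATION, PROVED: HSUB(ReachToric) from ANY upstairs invariant `G` with (B3a) an initialisation at the point step, (B3g) the four
centre facts for every stratum with a non-frame ray, (B3b) preservation under one strata step — by induction over `StrataTower` with `modelStep_chain` -/

section Iteration

/-- The STAGE TUPLE `modelStep_chain` consumes and produces, for a downstairs `(F, T)` modelled by `jm : F ⟶ X` in the stage `(X, σ, S)`. [OURS · abbreviation] -/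
def StageTuple (O : Type) [CommRing O] (k : Type) [Field k] (θ : O →+* k) (P : Scheme.{0}) (q : P ⟶ Spec (.of O))
    (Ch : ∀ X' : Scheme.{0}, (X' ⟶ P) → Set X' → Prop)
    (X : Scheme.{0}) (σ : X ⟶ P) (S : Set X) (F : Scheme.{0}) (jm : F ⟶ X) (t : F ⟶ Spec (.of k)) (T : Set F) : Prop :=
  Ch X σ S ∧ IsIntegral X ∧ IsLocallyNoetherian X ∧ Scheme.IsRegular X ∧ IsDominant (σ ≫ q) ∧ IsIntegral F ∧
    IsPullback jm t (σ ≫ q) (Spec.map (CommRingCat.ofHom θ)) ∧ jm '' T = S ∧ IsClosed T ∧ IsIrreducible T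

variable (O : Type) [CommRing O] [IsDomain O] [IsDiscreteValuationRing O] (k : Type) [Field k] (θ : O →+* k)
  (P : Scheme.{0}) (q : P ⟶ Spec (.of O)) (Y : Set P) (Ch : ∀ X' : Scheme.{0}, (X' ⟶ P) → Set X' → Prop)

/-- **(B3g) as a predicate on `G`**: at every stage, every stratum of a face with a non-frame ray whose downstairs stratum is E1-legal is, upstairs, a REGULAR,
`O`-FLAT centre with `comap jm = ` the downstairs stratum and off the generic point of `Y`.  [OURS · the centre-facts clause of the spec] -/
def StratumFacts (G : ∀ (X : Scheme.{0}) (_ : X ⟶ P) (F : Scheme.{0}) (_ : F ⟶ X), Boundary n X → Boundary n F → Prop) : Prop :=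
  ∀ (X : Scheme.{0}) (σ : X ⟶ P) (S : Set X) (F : Scheme.{0}) (jm : F ⟶ X) (t : F ⟶ Spec (.of k)) (T : Set F)
    (EX : Boundary n X) (E : Boundary n F), StageTuple O k θ P q Ch X σ S F jm t T → G X σ F jm EX E →
    ∀ τ : Finset (Ray n), (∃ ρ ∈ τ, ρ ∉ Set.range (e n)) → ((stratum E τ).support : Set F) ⊆ T →
      Scheme.IsRegular (stratum EX τ).subscheme ∧ Flat ((stratum EX τ).subschemeι ≫ σ ≫ q) ∧
      (stratum EX τ).comap jm = stratum E τ ∧ σ '' ((stratum EX τ).support : Set X) ⊆ {y : P | ¬ IsGenericPoint y Y}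

/-- **(B3b) as a predicate on `G`**: `G` survives one strata step (upstairs blow-up `τX` of the upstairs stratum, downstairs blow-up `υ` of the downstairs
stratum, the new model square `j'` with `j' ≫ τX = υ ≫ jm` produced by `modelStep_chain`), the boundaries being stepped along on both floors. [OURS · the
step clause of the spec] -/
def StepFacts (G : ∀ (X : Scheme.{0}) (_ : X ⟶ P) (F : Scheme.{0}) (_ : F ⟶ X), Boundary n X → Boundary n F → Prop) : Prop :=
  ∀ (X : Scheme.{0}) (σ : X ⟶ P) (S : Set X) (F : Scheme.{0}) (jm : F ⟶ X) (t : F ⟶ Spec (.of k)) (T : Set F)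
    (EX : Boundary n X) (E : Boundary n F), StageTuple O k θ P q Ch X σ S F jm t T → G X σ F jm EX E →
    ∀ τ : Finset (Ray n), (∃ ρ ∈ τ, ρ ∉ Set.range (e n)) → ((stratum E τ).support : Set F) ⊆ T → ¬ T ⊆ ((stratum E τ).support : Set F) →
    ∀ (X₂ : Scheme.{0}) (τX : X₂ ⟶ X), IsBlowup τX (stratum EX τ) → IsIntegral X₂ → IsLocallyNoetherian X₂ → Scheme.IsRegular X₂ →
    ∀ (F₂ : Scheme.{0}) (υ : F₂ ⟶ F), IsBlowup υ (stratum E τ) → IsIntegral F₂ →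
    ∀ (j' : F₂ ⟶ X₂) (t' : F₂ ⟶ Spec (.of k)), IsPullback j' t' ((τX ≫ σ) ≫ q) (Spec.map (CommRingCat.ofHom θ)) → j' ≫ τX = υ ≫ jm →
      G X₂ (τX ≫ σ) F₂ j' (EX.stepAlong (stratum EX τ) (∑ ρ ∈ τ, ρ) τX) (E.stepAlong (stratum E τ) (∑ ρ ∈ τ, ρ) υ)

/-- **The induction over strata towers** (engine context fixed): a `G`-good stage over `(F, E, T)` lifts every strata tower over `(F, E, T)`.
[OURS · L1 W4.5b · PROVED; `modelStep_chain` + `exists_isBlowup`] -/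
theorem strataTower_lift (hθ : Function.Surjective θ) (hYirr : IsIrreducible Y) (hYcl : IsClosed Y)
    (hChain : ∀ (X' : Scheme.{0}) (σ : X' ⟶ P) (S : Set X'), Ch X' σ S →
      Summit.ResolutionOfSingularities.ResolutionOfSingularities.Theses.EquisingularLift.Split.Chain P Y X' σ S)
    (hStep : ∀ (X' X'' : Scheme.{0}) (σ' : X' ⟶ P) (S' : Set X') (C : X'.IdealSheafData) (τ : X'' ⟶ X'),
      Ch X' σ' S' → IsBlowup τ C → Scheme.IsRegular C.subscheme → Flat (C.subschemeι ≫ σ' ≫ q) →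
      σ' '' (C.support : Set X') ⊆ {x : P | ¬ IsGenericPoint x Y} →
      (C.support : Set X') ∩ (σ' ≫ q) ⁻¹' {IsLocalRing.closedPoint O} ⊆ S' →
      Ch X'' (τ ≫ σ') (closure (τ ⁻¹' (S' \ (C.support : Set X')))))
    (G : ∀ (X : Scheme.{0}) (_ : X ⟶ P) (F : Scheme.{0}) (_ : F ⟶ X), Boundary n X → Boundary n F → Prop)
    (hstrat : StratumFacts (n := n) O k θ P q Y Ch G) (hstep : StepFacts (n := n) O k θ P q Ch G)
    {F : Scheme.{0}} {E : Boundary n F} {T : Set F} {F₉ : Scheme.{0}} {β : F₉ ⟶ F} {T₉ : Set F₉}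
    (h : StrataTower F E T F₉ β T₉) :
    ∀ (X : Scheme.{0}) (σ : X ⟶ P) (S : Set X) (jm : F ⟶ X) (t : F ⟶ Spec (.of k)) (EX : Boundary n X),
      StageTuple O k θ P q Ch X σ S F jm t T → G X σ F jm EX E →
      ∃ (X₉ : Scheme.{0}) (σ₉ : X₉ ⟶ P) (S₉ : Set X₉) (j₉ : F₉ ⟶ X₉) (t₉ : F₉ ⟶ Spec (.of k)),
        Ch X₉ σ₉ S₉ ∧ IsIntegral X₉ ∧ IsLocallyNoetherian X₉ ∧ Scheme.IsRegular X₉ ∧ IsDominant (σ₉ ≫ q) ∧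
        IsPullback j₉ t₉ (σ₉ ≫ q) (Spec.map (CommRingCat.ofHom θ)) ∧ j₉ '' T₉ = S₉ ∧
        IsClosed T₉ ∧ IsIrreducible T₉ ∧ IsIntegral F₉ := by
  induction h with
  | nil F E T =>
    intro X σ S jm t EX hst _
    obtain ⟨hCh, hXi, hXn, hXr, hdom, hFi, hsq, hTS, hTcl, hTirr⟩ := hst
    exact ⟨X, σ, S, jm, t, hCh, hXi, hXn, hXr, hdom, hsq, hTS, hTcl, hTirr, hFi⟩
  | cons F E T τ hτ hE1 hT F' υ hυ F₉ β T₉ hrest ih =>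
    intro X σ S jm t EX hst hG
    obtain ⟨hCh, hXi, hXn, hXr, hdom, hFi, hsq, hTS, hTcl, hTirr⟩ := hst
    -- the four centre facts for the upstairs stratum
    obtain ⟨hCreg, hCflat, hCD, hoff⟩ :=
      hstrat X σ S F jm t T EX E ⟨hCh, hXi, hXn, hXr, hdom, hFi, hsq, hTS, hTcl, hTirr⟩ hG τ hτ hE1
    -- blow the upstairs stratum up and run the model step
    obtain ⟨X₂, τX, hτX⟩ := exists_isBlowup X (stratum EX τ)
    haveI := hXi; haveI := hXn; haveI := hFi
    obtain ⟨hX₂i, hX₂n, hX₂r, hX₂dom, hF'i, hirr, j', t', hsq', hcomm, hCh'⟩ :=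
      modelStep_chain O k θ hθ P q Y hYirr hYcl Ch hChain hStep X σ S hCh hXr hdom F jm t hsq T hTS
        (stratum EX τ) (stratum E τ) hCD hCreg hCflat hoff hE1 hT X₂ τX hτX F' υ hυ
    -- the invariant survives the step
    have hG' := hstep X σ S F jm t T EX E ⟨hCh, hXi, hXn, hXr, hdom, hFi, hsq, hTS, hTcl, hTirr⟩ hG τ hτ hE1 hT
      X₂ τX hτX hX₂i hX₂n hX₂r F' υ hυ hF'i j' t' hsq' hcomm
    -- recurse
    obtain ⟨X₉, σ₉, S₉, j₉, t₉, h⟩ := ih X₂ (τX ≫ σ) (j' '' closure (υ ⁻¹' (T \ ((stratum E τ).support : Set F)))) j' t'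
      (EX.stepAlong (stratum EX τ) (∑ ρ ∈ τ, ρ) τX) ⟨hCh', hX₂i, hX₂n, hX₂r, hX₂dom, hF'i, hsq', rfl, isClosed_closure, hirr⟩ hG'
    exact ⟨X₉, σ₉, S₉, j₉, t₉, h⟩

end Iteration

/-- **(B3c) `hsub_of_invariant` — HSUB(ReachToric) FROM AN INVARIANT, PROVED.**  In K5′'s engine context after the point step, ANY predicate `G` on
(upstairs stage, model, upstairs boundary, downstairs boundary) that (B3a) holds for SOME upstairs boundary `Ẽ₁` on `X₁ = Bl_{ker s} X'` over the stepped
frame boundary of every frame at `x`, (B3g) yields the four centre facts, (B3b) survives strata steps, gives the conclusion of HSUB(ReachToric) for every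
`ReachToric`-admissible sub-chain.  So (B3) `hsub_strataLift` = «exhibit `G`» — the intended `G` is the SNC invariant «`F` :: frame lifts :: exceptionals is
SNC near the section's fibre, with the right stalks under `jm`» (module docstring).  [OURS · L1 W4.5b · PROVED; pure logic over `strataTower_lift`] -/
theorem hsub_of_invariant (k : Type) [Field k] (n : ℕ)
    (O : Type) [CommRing O] [IsDomain O] [IsDiscreteValuationRing O] (θ : O →+* k) (hθ : Function.Surjective θ)
    (P : Scheme.{0}) (q : P ⟶ Spec (.of O)) (Y : Set P) (Ch : ∀ X' : Scheme.{0}, (X' ⟶ P) → Set X' → Prop)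
    (hStep : ∀ (X' X'' : Scheme.{0}) (σ' : X' ⟶ P) (S' : Set X') (C : X'.IdealSheafData) (τ : X'' ⟶ X'),
      Ch X' σ' S' → IsBlowup τ C → Scheme.IsRegular C.subscheme → Flat (C.subschemeι ≫ σ' ≫ q) →
      σ' '' (C.support : Set X') ⊆ {x : P | ¬ IsGenericPoint x Y} →
      (C.support : Set X') ∩ (σ' ≫ q) ⁻¹' {IsLocalRing.closedPoint O} ⊆ S' →
      Ch X'' (τ ≫ σ') (closure (τ ⁻¹' (S' \ (C.support : Set X')))))
    (hChain : ∀ (X' : Scheme.{0}) (σ : X' ⟶ P) (S : Set X'), Ch X' σ S →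
      Summit.ResolutionOfSingularities.ResolutionOfSingularities.Theses.EquisingularLift.Split.Chain P Y X' σ S)
    (hYirr : IsIrreducible Y) (hYcl : IsClosed Y)
    -- the stage after the point step and the model of `F₂`
    (X₁ : Scheme.{0}) (σ₁ : X₁ ⟶ P) (hCh₁int : IsIntegral X₁) (hX₁n : IsLocallyNoetherian X₁) (hX₁r : Scheme.IsRegular X₁)
    (hX₁dom : IsDominant (σ₁ ≫ q))
    (F₁ F₂ : Scheme.{0}) (hF₂ : IsIntegral F₂) (υ : F₂ ⟶ F₁) (x : F₁) (T₂ : Set F₂) (hT₂cl : IsClosed T₂) (hT₂irr : IsIrreducible T₂)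
    (j₂ : F₂ ⟶ X₁) (t₂ : F₂ ⟶ Spec (.of k)) (hsq₂ : IsPullback j₂ t₂ (σ₁ ≫ q) (Spec.map (CommRingCat.ofHom θ)))
    (hCh₁ : Ch X₁ σ₁ (j₂ '' T₂))
    -- the invariant and its three clauses
    (G : ∀ (X : Scheme.{0}) (_ : X ⟶ P) (F : Scheme.{0}) (_ : F ⟶ X), Boundary n X → Boundary n F → Prop)
    (hinit : ∀ (hx : IsClosed ({x} : Set F₁)) (W : Fin n → F₁.IdealSheafData), IsFrameAt W x →
      ∃ EX₁ : Boundary n X₁, G X₁ σ₁ F₂ j₂ EX₁ ((frameBoundary W).stepAlong (vanishingIdeal (⟨{x}, hx⟩ : Closeds F₁)) 1 υ))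
    (hstrat : StratumFacts (n := n) O k θ P q Y Ch G) (hstep : StepFacts (n := n) O k θ P q Ch G)
    (F₉ : Scheme.{0}) (β : F₉ ⟶ F₂) (T₉ : Set F₉) (hR : ReachToric n F₁ F₂ υ x T₂ F₉ β T₉) :
    ∃ (X₉ : Scheme.{0}) (σ₉ : X₉ ⟶ P) (S₉ : Set X₉) (j₉ : F₉ ⟶ X₉) (t₉ : F₉ ⟶ Spec (.of k)),
      Ch X₉ σ₉ S₉ ∧ IsIntegral X₉ ∧ IsLocallyNoetherian X₉ ∧ Scheme.IsRegular X₉ ∧ IsDominant (σ₉ ≫ q) ∧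
      IsPullback j₉ t₉ (σ₉ ≫ q) (Spec.map (CommRingCat.ofHom θ)) ∧ j₉ '' T₉ = S₉ ∧
      IsClosed T₉ ∧ IsIrreducible T₉ ∧ IsIntegral F₉ := by
  obtain ⟨hx, W, hW, htower⟩ := hR
  obtain ⟨EX₁, hG₁⟩ := hinit hx W hW
  exact strataTower_lift (n := n) O k θ P q Y Ch hθ hYirr hYcl hChain hStep G hstrat hstep htower X₁ σ₁ (j₂ '' T₂) j₂ t₂ EX₁
    ⟨hCh₁, hCh₁int, hX₁n, hX₁r, hX₁dom, hF₂, hsq₂, rfl, hT₂cl, hT₂irr⟩ hG₁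

/-- **(B3) ⟸ «exhibit an invariant»**: the brick `hsub_strataLift` (K5′'s HSUB block at `ReachToric`) follows from ANY assignment, to each point-step
context K5′ hands over (ALL its binders up to `Ch X₁ (τ₁ ≫ σ') (j₂ '' T₂)` — in particular the model squares `j`, `j₂`, the section `s` with `s(𝔪) = j x` and
T-DIM, `τ₁ = Bl_{ker s}`, `j₂ ≫ τ₁ = υ ≫ j`, the carrier identity), of an invariant `G` with the three clauses (B3a) init / (B3g) `StratumFacts` / (B3b)
`StepFacts`.  [OURS · L1 W4.5b · PROVED; pure logic over `hsub_of_invariant`] -/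
theorem hsub_strataLift_of_invariant (k : Type) [Field k] (n : ℕ)
    (hGfam :
    (∀ (O : Type) [CommRing O] [IsDomain O] [IsDiscreteValuationRing O] [IsAdicComplete (IsLocalRing.maximalIdeal O) O]
        [IsAlgClosed (IsLocalRing.ResidueField O)] (θ : O →+* k), Function.Surjective θ →
      ∀ (P : AlgebraicGeometry.Scheme.{0}) (q : P ⟶ AlgebraicGeometry.Spec (.of O)) (Y : Set P)
        (Ch : ∀ X' : AlgebraicGeometry.Scheme.{0}, (X' ⟶ P) → Set X' → Prop),
        (∀ (X' X'' : AlgebraicGeometry.Scheme.{0}) (σ' : X' ⟶ P) (S' : Set X') (C : X'.IdealSheafData) (τ : X'' ⟶ X'),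
          Ch X' σ' S' → Literature.AlgebraicGeometry.Resolution.IsBlowup τ C →
          Literature.AlgebraicGeometry.Resolution.Scheme.IsRegular C.subscheme → AlgebraicGeometry.Flat (C.subschemeι ≫ σ' ≫ q) →
          σ' '' (C.support : Set X') ⊆ {y | ¬ IsGenericPoint y Y} →
          (C.support : Set X') ∩ (σ' ≫ q) ⁻¹' {IsLocalRing.closedPoint O} ⊆ S' →
          Ch X'' (τ ≫ σ') (closure (τ ⁻¹' (S' \ (C.support : Set X'))))) →
        (∀ (X' : AlgebraicGeometry.Scheme.{0}) (σ' : X' ⟶ P) (S' : Set X'), Ch X' σ' S' →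
          Summit.ResolutionOfSingularities.ResolutionOfSingularities.Theses.EquisingularLift.Split.Chain P Y X' σ' S') →
        Y ⊆ q ⁻¹' {IsLocalRing.closedPoint O} → IsIrreducible Y → IsClosed Y →
        AlgebraicGeometry.IsIntegral P → IsLocallyNoetherian P → Literature.AlgebraicGeometry.Resolution.Scheme.IsRegular P →
        AlgebraicGeometry.IsProper q → AlgebraicGeometry.SmoothOfRelativeDimension n q →
      -- the stage before the point step and its model
      ∀ (X' : AlgebraicGeometry.Scheme.{0}) (σ' : X' ⟶ P) (S' : Set X'), Ch X' σ' S' → AlgebraicGeometry.IsIntegral X' →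
        IsLocallyNoetherian X' → Literature.AlgebraicGeometry.Resolution.Scheme.IsRegular X' →
        AlgebraicGeometry.IsDominant (σ' ≫ q) →
      ∀ (F₁ : AlgebraicGeometry.Scheme.{0}), AlgebraicGeometry.IsIntegral F₁ → ∀ (j : F₁ ⟶ X')
        (t : F₁ ⟶ AlgebraicGeometry.Spec (.of k)),
        IsPullback j t (σ' ≫ q) (AlgebraicGeometry.Spec.map (CommRingCat.ofHom θ)) →
      ∀ (T₁ : Set F₁), IsClosed T₁ → IsIrreducible T₁ → j '' T₁ = S' →
      -- the point step: section, its blow-up, the new stage and its model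
      ∀ (x : F₁) (hx : IsClosed ({x} : Set F₁)) (U : X'.Opens), AlgebraicGeometry.Smooth (U.ι ≫ σ' ≫ q) →
      ∀ (s : AlgebraicGeometry.Spec (.of O) ⟶ X'), s ≫ σ' ≫ q = 𝟙 _ → s (IsLocalRing.closedPoint O) ∈ U →
        s (IsLocalRing.closedPoint O) = j x →
        ringKrullDim (X'.presheaf.stalk (s (IsLocalRing.closedPoint O))) = ((n + 1 : ℕ) : WithBot ℕ∞) →
        IsRegularLocalRing (F₁.presheaf.stalk x) →
        (∀ c ∈ (s.ker.support : Set X'), ¬ IsGenericPoint (σ' c) Y) →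
      ∀ (X₁ : AlgebraicGeometry.Scheme.{0}) (τ₁ : X₁ ⟶ X'), Literature.AlgebraicGeometry.Resolution.IsBlowup τ₁ s.ker →
        AlgebraicGeometry.IsIntegral X₁ → IsLocallyNoetherian X₁ → Literature.AlgebraicGeometry.Resolution.Scheme.IsRegular X₁ →
        AlgebraicGeometry.IsDominant ((τ₁ ≫ σ') ≫ q) →
      ∀ (F₂ : AlgebraicGeometry.Scheme.{0}), AlgebraicGeometry.IsIntegral F₂ → ∀ (υ : F₂ ⟶ F₁),
        Literature.AlgebraicGeometry.Resolution.IsBlowup υ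
          (AlgebraicGeometry.Scheme.IdealSheafData.vanishingIdeal (⟨{x}, hx⟩ : TopologicalSpace.Closeds F₁)) →
      ∀ (j₂ : F₂ ⟶ X₁) (t₂ : F₂ ⟶ AlgebraicGeometry.Spec (.of k)),
        IsPullback j₂ t₂ ((τ₁ ≫ σ') ≫ q) (AlgebraicGeometry.Spec.map (CommRingCat.ofHom θ)) → j₂ ≫ τ₁ = υ ≫ j →
        (s.ker.comap τ₁).comap j₂ =
          (AlgebraicGeometry.Scheme.IdealSheafData.vanishingIdeal (⟨{x}, hx⟩ : TopologicalSpace.Closeds F₁)).comap υ →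
        IsIrreducible (closure (υ ⁻¹' (T₁ \ {x}))) →
        Ch X₁ (τ₁ ≫ σ') (j₂ '' closure (υ ⁻¹' (T₁ \ {x}))) →
      ∃ G : ∀ (X : AlgebraicGeometry.Scheme.{0}) (_ : X ⟶ P) (F : AlgebraicGeometry.Scheme.{0}) (_ : F ⟶ X), Boundary n X → Boundary n F → Prop,
        (∀ (hx' : IsClosed ({x} : Set F₁)) (W : Fin n → F₁.IdealSheafData), IsFrameAt W x →
          ∃ EX₁ : Boundary n X₁, G X₁ (τ₁ ≫ σ') F₂ j₂ EX₁
            ((frameBoundary W).stepAlong (AlgebraicGeometry.Scheme.IdealSheafData.vanishingIdeal (⟨{x}, hx'⟩ : TopologicalSpace.Closeds F₁)) 1 υ)) ∧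
        StratumFacts (n := n) O k θ P q Y Ch G ∧ StepFacts (n := n) O k θ P q Ch G)) :
    (∀ (O : Type) [CommRing O] [IsDomain O] [IsDiscreteValuationRing O] [IsAdicComplete (IsLocalRing.maximalIdeal O) O]
        [IsAlgClosed (IsLocalRing.ResidueField O)] (θ : O →+* k), Function.Surjective θ →
      ∀ (P : AlgebraicGeometry.Scheme.{0}) (q : P ⟶ AlgebraicGeometry.Spec (.of O)) (Y : Set P)
        (Ch : ∀ X' : AlgebraicGeometry.Scheme.{0}, (X' ⟶ P) → Set X' → Prop),
        (∀ (X' X'' : AlgebraicGeometry.Scheme.{0}) (σ' : X' ⟶ P) (S' : Set X') (C : X'.IdealSheafData) (τ : X'' ⟶ X'),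
          Ch X' σ' S' → Literature.AlgebraicGeometry.Resolution.IsBlowup τ C →
          Literature.AlgebraicGeometry.Resolution.Scheme.IsRegular C.subscheme → AlgebraicGeometry.Flat (C.subschemeι ≫ σ' ≫ q) →
          σ' '' (C.support : Set X') ⊆ {y | ¬ IsGenericPoint y Y} →
          (C.support : Set X') ∩ (σ' ≫ q) ⁻¹' {IsLocalRing.closedPoint O} ⊆ S' →
          Ch X'' (τ ≫ σ') (closure (τ ⁻¹' (S' \ (C.support : Set X'))))) →
        (∀ (X' : AlgebraicGeometry.Scheme.{0}) (σ' : X' ⟶ P) (S' : Set X'), Ch X' σ' S' →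
          Summit.ResolutionOfSingularities.ResolutionOfSingularities.Theses.EquisingularLift.Split.Chain P Y X' σ' S') →
        Y ⊆ q ⁻¹' {IsLocalRing.closedPoint O} → IsIrreducible Y → IsClosed Y →
        AlgebraicGeometry.IsIntegral P → IsLocallyNoetherian P → Literature.AlgebraicGeometry.Resolution.Scheme.IsRegular P →
        AlgebraicGeometry.IsProper q → AlgebraicGeometry.SmoothOfRelativeDimension n q →
      -- the stage before the point step and its model
      ∀ (X' : AlgebraicGeometry.Scheme.{0}) (σ' : X' ⟶ P) (S' : Set X'), Ch X' σ' S' → AlgebraicGeometry.IsIntegral X' →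
        IsLocallyNoetherian X' → Literature.AlgebraicGeometry.Resolution.Scheme.IsRegular X' →
        AlgebraicGeometry.IsDominant (σ' ≫ q) →
      ∀ (F₁ : AlgebraicGeometry.Scheme.{0}), AlgebraicGeometry.IsIntegral F₁ → ∀ (j : F₁ ⟶ X')
        (t : F₁ ⟶ AlgebraicGeometry.Spec (.of k)),
        IsPullback j t (σ' ≫ q) (AlgebraicGeometry.Spec.map (CommRingCat.ofHom θ)) →
      ∀ (T₁ : Set F₁), IsClosed T₁ → IsIrreducible T₁ → j '' T₁ = S' →
      -- the point step: section, its blow-up, the new stage and its model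
      ∀ (x : F₁) (hx : IsClosed ({x} : Set F₁)) (U : X'.Opens), AlgebraicGeometry.Smooth (U.ι ≫ σ' ≫ q) →
      ∀ (s : AlgebraicGeometry.Spec (.of O) ⟶ X'), s ≫ σ' ≫ q = 𝟙 _ → s (IsLocalRing.closedPoint O) ∈ U →
        s (IsLocalRing.closedPoint O) = j x →
        ringKrullDim (X'.presheaf.stalk (s (IsLocalRing.closedPoint O))) = ((n + 1 : ℕ) : WithBot ℕ∞) →
        IsRegularLocalRing (F₁.presheaf.stalk x) →
        (∀ c ∈ (s.ker.support : Set X'), ¬ IsGenericPoint (σ' c) Y) →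
      ∀ (X₁ : AlgebraicGeometry.Scheme.{0}) (τ₁ : X₁ ⟶ X'), Literature.AlgebraicGeometry.Resolution.IsBlowup τ₁ s.ker →
        AlgebraicGeometry.IsIntegral X₁ → IsLocallyNoetherian X₁ → Literature.AlgebraicGeometry.Resolution.Scheme.IsRegular X₁ →
        AlgebraicGeometry.IsDominant ((τ₁ ≫ σ') ≫ q) →
      ∀ (F₂ : AlgebraicGeometry.Scheme.{0}), AlgebraicGeometry.IsIntegral F₂ → ∀ (υ : F₂ ⟶ F₁),
        Literature.AlgebraicGeometry.Resolution.IsBlowup υ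
          (AlgebraicGeometry.Scheme.IdealSheafData.vanishingIdeal (⟨{x}, hx⟩ : TopologicalSpace.Closeds F₁)) →
      ∀ (j₂ : F₂ ⟶ X₁) (t₂ : F₂ ⟶ AlgebraicGeometry.Spec (.of k)),
        IsPullback j₂ t₂ ((τ₁ ≫ σ') ≫ q) (AlgebraicGeometry.Spec.map (CommRingCat.ofHom θ)) → j₂ ≫ τ₁ = υ ≫ j →
        (s.ker.comap τ₁).comap j₂ =
          (AlgebraicGeometry.Scheme.IdealSheafData.vanishingIdeal (⟨{x}, hx⟩ : TopologicalSpace.Closeds F₁)).comap υ →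
        IsIrreducible (closure (υ ⁻¹' (T₁ \ {x}))) →
        Ch X₁ (τ₁ ≫ σ') (j₂ '' closure (υ ⁻¹' (T₁ \ {x}))) →
      -- the admissible downstairs sub-chains are matched upstairs
      ∀ (F₉ : AlgebraicGeometry.Scheme.{0}) (β : F₉ ⟶ F₂) (T₉ : Set F₉), ReachToric n F₁ F₂ υ x (closure (υ ⁻¹' (T₁ \ {x}))) F₉ β T₉ →
        ∃ (X₉ : AlgebraicGeometry.Scheme.{0}) (σ₉ : X₉ ⟶ P) (S₉ : Set X₉) (j₉ : F₉ ⟶ X₉)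
          (t₉ : F₉ ⟶ AlgebraicGeometry.Spec (.of k)),
          Ch X₉ σ₉ S₉ ∧ AlgebraicGeometry.IsIntegral X₉ ∧ IsLocallyNoetherian X₉ ∧
          Literature.AlgebraicGeometry.Resolution.Scheme.IsRegular X₉ ∧ AlgebraicGeometry.IsDominant (σ₉ ≫ q) ∧
          IsPullback j₉ t₉ (σ₉ ≫ q) (AlgebraicGeometry.Spec.map (CommRingCat.ofHom θ)) ∧ j₉ '' T₉ = S₉ ∧
          IsClosed T₉ ∧ IsIrreducible T₉ ∧ AlgebraicGeometry.IsIntegral F₉) := by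
  intro O _ _ _ _ _ θ hθ P q Y Ch hStep hChain hYq hYirr hYcl hPint hPn hPreg hqpr hqsm X' σ' S' hCh hX'i hX'n hX'r hdom F₁ hF₁ j t hsq
    T₁ hT₁cl hT₁irr hjT x hx U hU s hs hsU hsx hdim hregx hoffs X₁ τ₁ hτ₁ hX₁i hX₁n hX₁r hX₁dom F₂ hF₂ υ hυ j₂ t₂ hsq₂ hcomm hcarr
    hT₂irr hCh₁ F₉ β T₉ hR
  obtain ⟨G, hinit, hstrat, hstep⟩ :=
    hGfam O θ hθ P q Y Ch hStep hChain hYq hYirr hYcl hPint hPn hPreg hqpr hqsm X' σ' S' hCh hX'i hX'n hX'r hdom F₁ hF₁ j t hsq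
      T₁ hT₁cl hT₁irr hjT x hx U hU s hs hsU hsx hdim hregx hoffs X₁ τ₁ hτ₁ hX₁i hX₁n hX₁r hX₁dom F₂ hF₂ υ hυ j₂ t₂ hsq₂ hcomm hcarr
      hT₂irr hCh₁
  exact hsub_of_invariant k n O θ hθ P q Y Ch hStep hChain hYirr hYcl X₁ (τ₁ ≫ σ') hX₁i hX₁n hX₁r hX₁dom F₁ F₂ hF₂ υ x
    (closure (υ ⁻¹' (T₁ \ {x}))) isClosed_closure hT₂irr j₂ t₂ hsq₂ hCh₁ G hinit hstrat hstep F₉ β T₉ hR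

/-! ## 13.7 (B3a)/(B3g)/(B3b) — the CANDIDATE invariant `SNCInv` (idea-1's proposal; the O-side owners may refine it, `hsub_strataLift_of_invariant` accepts
any `G`), its three clauses as the bricks to prove, and (B3) `hsub_strataLift` DERIVED from them -/

section Invariant

variable (P : Scheme.{0}) (Y : Set P)

/-- **`SNCInv`** — «the special fibre and the present boundary members are SNC near the upstairs exceptional locus, and the two floors' boundaries match under
the model `jm`».  Data: an open `U ⊆ X` and a finite set `R` of PRESENT rays.  Clauses: (a) absent rays carry `⊤` on both floors; (b) for every present
NON-FRAME ray, the upstairs divisor's support lies in `U` and off the generic point of `Y` (it lies over the section, `off_generic_of_subset_preimage`);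
(c) on `U`, `jm.ker ∣_U` (the special fibre `F = V(ϖ)`) `::` the present members is an SNC family (`Literature…HasSNC`; so `ϖ` is a parameter TRANSVERSAL to
every stratum — the source of `O`-flatness over the DVR), no present member coinciding with the fibre on `U`; (d) MODEL COMPATIBILITY: present non-frame rays
EXACTLY (`(EX ρ)·𝒪_F = E ρ` — true by the carrier identity at creation and by the SNC chart formulas `ChartData.stalkIdeal_strictTransform_w/_x` under
later steps), frame rays on STALKS at the points of the downstairs exceptional locus (the frame lifts agree with the frame only near `x`).  From (a)–(d):
`StratumFacts` by `isRegular_subscheme_finsetSup` (on `U`), DVR-flatness from transversality (companion §12.17 `flat_specMap_quot_span_X` is the chart form),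
`comap_finsetSup` + `stalkIdeal_finsetSup` + `le_of_forall_stalkIdeal_le`, and (b); `StepFacts` by `HasSNCWith.hasSNC_transform` on `τX ∣_ U`
(`IsBlowup.restrict`) with `U₂ := τX⁻¹ U`.  [OURS · L1 W4.5b · CANDIDATE definition] -/
def SNCInv (X : Scheme.{0}) (σ : X ⟶ P) (F : Scheme.{0}) (jm : F ⟶ X) (EX : Boundary n X) (E : Boundary n F) : Prop :=
  ∃ (U : X.Opens) (R : Finset (Ray n)),
    -- (a) absent rays
    (∀ ρ, ρ ∉ R → EX ρ = ⊤ ∧ E ρ = ⊤) ∧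
    -- (b) the upstairs exceptional locus lies in `U` and off the generic point of `Y`
    (∀ ρ ∈ R, ρ ∉ Set.range (e n) →
      ((EX ρ).support : Set X) ⊆ (U : Set X) ∧ σ '' ((EX ρ).support : Set X) ⊆ {y : P | ¬ IsGenericPoint y Y}) ∧
    -- (c) SNC on `U` of «special fibre :: present members», the fibre being none of the members
    HasSNC ((jm.ker.comap U.ι) :: (R.toList.map fun ρ => (EX ρ).comap U.ι)) ∧
    (∀ ρ ∈ R, (EX ρ).comap U.ι ≠ jm.ker.comap U.ι) ∧
    -- (d) model compatibility of the two floors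
    (∀ ρ ∈ R, ρ ∉ Set.range (e n) → (EX ρ).comap jm = E ρ) ∧
    (∀ (i : Fin n) (y : F), (∃ ρ ∈ R, ρ ∉ Set.range (e n) ∧ y ∈ ((E ρ).support : Set F)) →
      stalkIdeal ((EX (e n i)).comap jm) y = stalkIdeal (E (e n i)) y)

end Invariant


-- ===== FILE C: …NatNDRounds.lean (§13.9 + §13.10) =====

/-! ## 13.9 (B4δ) THE k-SIDE ITERATION, PROVED: `hres`(ReachToric) from ANY downstairs invariant `DI m F ρ T` (m = a termination measure, e.g. the number of
non-regular points of the reduced closure of `T`) with (B4-init) it holds for `(ℙⁿ_k, 𝟙, range ι)`, (B4-end) at `m = 0` the reduced closure is regular,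
(B4-round) at `m + 1` there is a non-regular closed point `x` (ambient regular at `x`) such that after ANY blow-up of `x` some `ReachToric` tower reaches `DI m'`,
`m' ≤ m` — strong induction on `m` through K5′'s closure operator `Q`.  So (B4) `hres_toricRounds` = «exhibit `DI`» (the intended `DI`: §5 of the ENGINE WORD). -/

section Rounds

variable (n : ℕ) (k : Type) [Field k]

/-- K5′'s closure condition on a downstairs predicate `Q` (the inner block of `hres`, VERBATIM): closed under «point step, and every `ReachToric` tower after it».
[OURS · abbreviation] -/
def RoundClosed (Q : ∀ F₁ : AlgebraicGeometry.Scheme.{0}, (F₁ ⟶ (Literature.AlgebraicGeometry.Motives.projectiveSpace n k).left) → Set F₁ → Prop) : Prop :=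
  ∀ (F₁ F₂ : AlgebraicGeometry.Scheme.{0}) (ρ : F₁ ⟶ (Literature.AlgebraicGeometry.Motives.projectiveSpace n k).left)
            (T₁ : Set F₁)
            (x : ↥(AlgebraicGeometry.Scheme.IdealSheafData.vanishingIdeal (⟨closure T₁, isClosed_closure⟩ : TopologicalSpace.Closeds F₁)).subscheme)
            (υ : F₂ ⟶ F₁)
            (hx : IsClosed ({((AlgebraicGeometry.Scheme.IdealSheafData.vanishingIdeal (⟨closure T₁, isClosed_closure⟩ : TopologicalSpace.Closeds F₁)).subschemeι x : F₁)} : Set F₁)),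
          Q F₁ ρ T₁ →
          ¬ IsRegularLocalRing ((AlgebraicGeometry.Scheme.IdealSheafData.vanishingIdeal (⟨closure T₁, isClosed_closure⟩ : TopologicalSpace.Closeds F₁)).subscheme.presheaf.stalk x) →
          IsRegularLocalRing (F₁.presheaf.stalk ((AlgebraicGeometry.Scheme.IdealSheafData.vanishingIdeal (⟨closure T₁, isClosed_closure⟩ : TopologicalSpace.Closeds F₁)).subschemeι x : F₁)) →
          Literature.AlgebraicGeometry.Resolution.IsBlowup υ
            (AlgebraicGeometry.Scheme.IdealSheafData.vanishingIdeal (⟨{((AlgebraicGeometry.Scheme.IdealSheafData.vanishingIdeal (⟨closure T₁, isClosed_closure⟩ : TopologicalSpace.Closeds F₁)).subschemeι x : F₁)}, hx⟩ : TopologicalSpace.Closeds F₁)) →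
          Q F₂ (υ ≫ ρ) (closure (υ ⁻¹' (T₁ \ {((AlgebraicGeometry.Scheme.IdealSheafData.vanishingIdeal (⟨closure T₁, isClosed_closure⟩ : TopologicalSpace.Closeds F₁)).subschemeι x : F₁)}))) ∧
          (∀ (F₉ : AlgebraicGeometry.Scheme.{0}) (β : F₉ ⟶ F₂) (T₉ : Set F₉),
            ReachToric n F₁ F₂ υ ((AlgebraicGeometry.Scheme.IdealSheafData.vanishingIdeal (⟨closure T₁, isClosed_closure⟩ : TopologicalSpace.Closeds F₁)).subschemeι x : F₁) (closure (υ ⁻¹' (T₁ \ {((AlgebraicGeometry.Scheme.IdealSheafData.vanishingIdeal (⟨closure T₁, isClosed_closure⟩ : TopologicalSpace.Closeds F₁)).subschemeι x : F₁)}))) F₉ β T₉ →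
            Q F₉ ((β ≫ υ) ≫ ρ) T₉)

/-- **(B4-round) as a predicate on `DI`**: at measure `m + 1` one round is possible and lowers the measure. [OURS · the round clause of the k-side spec] -/
def RoundFacts (DI : ℕ → ∀ F₁ : AlgebraicGeometry.Scheme.{0}, (F₁ ⟶ (Literature.AlgebraicGeometry.Motives.projectiveSpace n k).left) → Set F₁ → Prop) : Prop :=
  ∀ (m : ℕ) (F₁ : AlgebraicGeometry.Scheme.{0}) (ρ : F₁ ⟶ (Literature.AlgebraicGeometry.Motives.projectiveSpace n k).left) (T₁ : Set F₁), DI (m + 1) F₁ ρ T₁ →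
    ∃ (x : ↥(AlgebraicGeometry.Scheme.IdealSheafData.vanishingIdeal (⟨closure T₁, isClosed_closure⟩ : TopologicalSpace.Closeds F₁)).subscheme) (hx : IsClosed ({((AlgebraicGeometry.Scheme.IdealSheafData.vanishingIdeal (⟨closure T₁, isClosed_closure⟩ : TopologicalSpace.Closeds F₁)).subschemeι x : F₁)} : Set F₁)),
      ¬ IsRegularLocalRing ((AlgebraicGeometry.Scheme.IdealSheafData.vanishingIdeal (⟨closure T₁, isClosed_closure⟩ : TopologicalSpace.Closeds F₁)).subscheme.presheaf.stalk x) ∧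
      IsRegularLocalRing (F₁.presheaf.stalk ((AlgebraicGeometry.Scheme.IdealSheafData.vanishingIdeal (⟨closure T₁, isClosed_closure⟩ : TopologicalSpace.Closeds F₁)).subschemeι x : F₁)) ∧
      ∀ (F₂ : AlgebraicGeometry.Scheme.{0}) (υ : F₂ ⟶ F₁),
        Literature.AlgebraicGeometry.Resolution.IsBlowup υ
          (AlgebraicGeometry.Scheme.IdealSheafData.vanishingIdeal (⟨{((AlgebraicGeometry.Scheme.IdealSheafData.vanishingIdeal (⟨closure T₁, isClosed_closure⟩ : TopologicalSpace.Closeds F₁)).subschemeι x : F₁)}, hx⟩ : TopologicalSpace.Closeds F₁)) →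
        ∃ (F₉ : AlgebraicGeometry.Scheme.{0}) (β : F₉ ⟶ F₂) (T₉ : Set F₉),
          ReachToric n F₁ F₂ υ ((AlgebraicGeometry.Scheme.IdealSheafData.vanishingIdeal (⟨closure T₁, isClosed_closure⟩ : TopologicalSpace.Closeds F₁)).subschemeι x : F₁) (closure (υ ⁻¹' (T₁ \ {((AlgebraicGeometry.Scheme.IdealSheafData.vanishingIdeal (⟨closure T₁, isClosed_closure⟩ : TopologicalSpace.Closeds F₁)).subschemeι x : F₁)}))) F₉ β T₉ ∧
          ∃ m' ≤ m, DI m' F₉ ((β ≫ υ) ≫ ρ) T₉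

/-- **The strong induction over rounds** (any `DI` with end and round clauses): from `DI m F ρ T`, a resolved end `(F', ρ', T')` reachable through every
`RoundClosed` predicate.  [OURS · L1 W4.5b · PROVED; `exists_isBlowup` + logic] -/
theorem rounds_resolve (DI : ℕ → ∀ F₁ : AlgebraicGeometry.Scheme.{0}, (F₁ ⟶ (Literature.AlgebraicGeometry.Motives.projectiveSpace n k).left) → Set F₁ → Prop)
    (hend : ∀ (F₁ : AlgebraicGeometry.Scheme.{0}) (ρ : F₁ ⟶ (Literature.AlgebraicGeometry.Motives.projectiveSpace n k).left) (T₁ : Set F₁), DI 0 F₁ ρ T₁ →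
      Literature.AlgebraicGeometry.Resolution.Scheme.IsRegular (AlgebraicGeometry.Scheme.IdealSheafData.vanishingIdeal (⟨closure T₁, isClosed_closure⟩ : TopologicalSpace.Closeds F₁)).subscheme)
    (hround : RoundFacts n k DI) :
    ∀ (m : ℕ) (F₁ : AlgebraicGeometry.Scheme.{0}) (ρ : F₁ ⟶ (Literature.AlgebraicGeometry.Motives.projectiveSpace n k).left) (T₁ : Set F₁), DI m F₁ ρ T₁ →
      ∃ (F' : AlgebraicGeometry.Scheme.{0}) (ρ' : F' ⟶ (Literature.AlgebraicGeometry.Motives.projectiveSpace n k).left) (T' : Set F'),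
        (∀ Q : (∀ F₁ : AlgebraicGeometry.Scheme.{0}, (F₁ ⟶ (Literature.AlgebraicGeometry.Motives.projectiveSpace n k).left) → Set F₁ → Prop), RoundClosed n k Q → Q F₁ ρ T₁ → Q F' ρ' T') ∧
        Literature.AlgebraicGeometry.Resolution.Scheme.IsRegular (AlgebraicGeometry.Scheme.IdealSheafData.vanishingIdeal
          (⟨closure T', isClosed_closure⟩ : TopologicalSpace.Closeds F')).subscheme := by
  intro m
  induction m using Nat.strong_induction_on with
  | _ m ih =>
    intro F₁ ρ T₁ hDI
    cases m with
    | zero => exact ⟨F₁, ρ, T₁, fun Q _ hQ => hQ, hend F₁ ρ T₁ hDI⟩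
    | succ m =>
      obtain ⟨x, hx, hnreg, hreg, hcont⟩ := hround m F₁ ρ T₁ hDI
      obtain ⟨F₂, υ, hυ⟩ := exists_isBlowup F₁
        (AlgebraicGeometry.Scheme.IdealSheafData.vanishingIdeal (⟨{((AlgebraicGeometry.Scheme.IdealSheafData.vanishingIdeal (⟨closure T₁, isClosed_closure⟩ : TopologicalSpace.Closeds F₁)).subschemeι x : F₁)}, hx⟩ : TopologicalSpace.Closeds F₁))
      obtain ⟨F₉, β, T₉, hR, m', hm', hDI'⟩ := hcont F₂ υ hυ
      obtain ⟨F', ρ', T', hQ', hreg'⟩ := ih m' (Nat.lt_succ_of_le hm') F₉ ((β ≫ υ) ≫ ρ) T₉ hDI'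
      refine ⟨F', ρ', T', fun Q hQc hQ => ?_, hreg'⟩
      have hstep := hQc F₁ F₂ ρ T₁ x υ hx hQ hnreg hreg hυ
      exact hQ' Q hQc (hstep.2 F₉ β T₉ hR)

/-- **(B4δ) `hres_of_rounds` — `hres`(ReachToric) FROM A DOWNSTAIRS INVARIANT, PROVED.**  [OURS · L1 W4.5b · pure logic over `rounds_resolve`] -/
theorem hres_of_rounds [IsAlgClosed k] (H : AlgebraicGeometry.Scheme.{0}) (ι : H ⟶ (Literature.AlgebraicGeometry.Motives.projectiveSpace n k).left)
    (DI : ℕ → ∀ F₁ : AlgebraicGeometry.Scheme.{0}, (F₁ ⟶ (Literature.AlgebraicGeometry.Motives.projectiveSpace n k).left) → Set F₁ → Prop)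
    (hinit : ∃ m, DI m (Literature.AlgebraicGeometry.Motives.projectiveSpace n k).left (𝟙 (Literature.AlgebraicGeometry.Motives.projectiveSpace n k).left) (Set.range ι))
    (hend : ∀ (F₁ : AlgebraicGeometry.Scheme.{0}) (ρ : F₁ ⟶ (Literature.AlgebraicGeometry.Motives.projectiveSpace n k).left) (T₁ : Set F₁), DI 0 F₁ ρ T₁ →
      Literature.AlgebraicGeometry.Resolution.Scheme.IsRegular (AlgebraicGeometry.Scheme.IdealSheafData.vanishingIdeal (⟨closure T₁, isClosed_closure⟩ : TopologicalSpace.Closeds F₁)).subscheme)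
    (hround : RoundFacts n k DI) :
    (∃ (F' : AlgebraicGeometry.Scheme.{0}) (ρ' : F' ⟶ (Literature.AlgebraicGeometry.Motives.projectiveSpace n k).left)
        (T' : Set F'),
      (∀ Q : (∀ F₁ : AlgebraicGeometry.Scheme.{0}, (F₁ ⟶ (Literature.AlgebraicGeometry.Motives.projectiveSpace n k).left) →
          Set F₁ → Prop),
        Q (Literature.AlgebraicGeometry.Motives.projectiveSpace n k).left
          (𝟙 (Literature.AlgebraicGeometry.Motives.projectiveSpace n k).left) (Set.range ι) →
        (∀ (F₁ F₂ : AlgebraicGeometry.Scheme.{0}) (ρ : F₁ ⟶ (Literature.AlgebraicGeometry.Motives.projectiveSpace n k).left)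
            (T₁ : Set F₁)
            (x : ↥(AlgebraicGeometry.Scheme.IdealSheafData.vanishingIdeal
              (⟨closure T₁, isClosed_closure⟩ : TopologicalSpace.Closeds F₁)).subscheme)
            (υ : F₂ ⟶ F₁)
            (hx : IsClosed ({((AlgebraicGeometry.Scheme.IdealSheafData.vanishingIdeal
              (⟨closure T₁, isClosed_closure⟩ : TopologicalSpace.Closeds F₁)).subschemeι x : F₁)} : Set F₁)),
          Q F₁ ρ T₁ →
          ¬ IsRegularLocalRing ((AlgebraicGeometry.Scheme.IdealSheafData.vanishingIdeal
              (⟨closure T₁, isClosed_closure⟩ : TopologicalSpace.Closeds F₁)).subscheme.presheaf.stalk x) →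
          IsRegularLocalRing (F₁.presheaf.stalk ((AlgebraicGeometry.Scheme.IdealSheafData.vanishingIdeal
              (⟨closure T₁, isClosed_closure⟩ : TopologicalSpace.Closeds F₁)).subschemeι x)) →
          Literature.AlgebraicGeometry.Resolution.IsBlowup υ
            (AlgebraicGeometry.Scheme.IdealSheafData.vanishingIdeal
              (⟨{((AlgebraicGeometry.Scheme.IdealSheafData.vanishingIdeal
                (⟨closure T₁, isClosed_closure⟩ : TopologicalSpace.Closeds F₁)).subschemeι x : F₁)}, hx⟩ :
                TopologicalSpace.Closeds F₁)) →
          Q F₂ (υ ≫ ρ) (closure (υ ⁻¹' (T₁ \ {((AlgebraicGeometry.Scheme.IdealSheafData.vanishingIdeal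
              (⟨closure T₁, isClosed_closure⟩ : TopologicalSpace.Closeds F₁)).subschemeι x : F₁)}))) ∧
          (∀ (F₉ : AlgebraicGeometry.Scheme.{0}) (β : F₉ ⟶ F₂) (T₉ : Set F₉),
            ReachToric n F₁ F₂ υ ((AlgebraicGeometry.Scheme.IdealSheafData.vanishingIdeal
                (⟨closure T₁, isClosed_closure⟩ : TopologicalSpace.Closeds F₁)).subschemeι x)
              (closure (υ ⁻¹' (T₁ \ {((AlgebraicGeometry.Scheme.IdealSheafData.vanishingIdeal
                (⟨closure T₁, isClosed_closure⟩ : TopologicalSpace.Closeds F₁)).subschemeι x : F₁)}))) F₉ β T₉ →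
            Q F₉ ((β ≫ υ) ≫ ρ) T₉)) →
        Q F' ρ' T') ∧
      Literature.AlgebraicGeometry.Resolution.Scheme.IsRegular (AlgebraicGeometry.Scheme.IdealSheafData.vanishingIdeal
        (⟨closure T', isClosed_closure⟩ : TopologicalSpace.Closeds F')).subscheme) := by
  obtain ⟨m, hm⟩ := hinit
  obtain ⟨F', ρ', T', hQ, hreg⟩ := rounds_resolve n k DI hend hround m _ _ _ hm
  exact ⟨F', ρ', T', fun Q hQ0 hQc => hQ Q hQc hQ0, hreg⟩

end Rounds

/-! ## 13.10 (B4, ROUND 10 preview) THE CANDIDATE DOWNSTAIRS INVARIANT `NDInv` and its clauses (B4-init) / (B4-end, PROVED) / (B4-round)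

`NDInv m F ρ T`: the ambient floor `F` is regular, and the reduced closure `T̂` of `T` has EXACTLY the finite set `S` (`|S| = m`) of non-regular points, each a
closed point carrying LOCAL ND FRAME DATA (`IsNDFrameAt`): a frame `W` with stalk generators `w₁,…,wₙ` (an r.s.p. of `𝒪_{F,x}`, `dim = n`) and a polynomial
`g ∈ LocalNDWon` (tree `…Sections.LocalNDWon`: convenient + locally Newton-nondegenerate + a WON E1-legal play) with `(𝓘_T̂)_x = (g(w))`, coefficients through the
structure map `k → 𝒪_{F,x}` of the `ℙⁿ_k`-scheme `F` (`baseToStalk`).  GERM-level like `IsFrameAt` (the étale chart `V → 𝔸ⁿ_k`, `t ↦ w`, is DERIVED by the provers: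
`Literature.AlgebraicGeometry.Resolution.localRingHom_flat_and_formallyUnramified` is the field-case template).  The k-side owner may strengthen `NDInv`
(e.g. add `IsIntegral F`, `IsLocallyNoetherian F`) without touching §13.9. -/

section NDInvariant

variable (n : ℕ) (k : Type) [Field k]

/-- The structure map `k → 𝒪_{F,x}` of a scheme `ρ : F → ℙⁿ_k` over `ℙⁿ_k` (through global sections of `Spec k` and the germ at `x`). [OURS · plumbing] -/
noncomputable def baseToStalk {F : AlgebraicGeometry.Scheme.{0}} (ρ : F ⟶ (Literature.AlgebraicGeometry.Motives.projectiveSpace n k).left) (x : F) : k →+* (F.presheaf.stalk x : Type _) :=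
  (F.presheaf.germ ⊤ x trivial).hom.comp
    (((ρ ≫ (Literature.AlgebraicGeometry.Motives.projectiveSpace n k).hom).appTop).hom.comp
      (AlgebraicGeometry.Scheme.ΓSpecIso (CommRingCat.of k)).inv.hom)

/-- **LOCAL ND FRAME DATA at `x`** for `(F, ρ, T)` and a frame `W`: stalk generators `w` of the `W j` forming an r.s.p. of the `n`-dimensional `𝒪_{F,x}`, and
`g ∈ LocalNDWon` with `(𝓘_{closure T, red})_x = (g(w))`.  Implies `IsFrameAt W x` (`isFrameAt_of_isNDFrameAt`). [OURS · L1 W4.5b · definition] -/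
def IsNDFrameAt {F : AlgebraicGeometry.Scheme.{0}} (ρ : F ⟶ (Literature.AlgebraicGeometry.Motives.projectiveSpace n k).left) (T : Set F) (W : Fin n → F.IdealSheafData) (x : F) : Prop :=
  ∃ (w : Fin n → F.presheaf.stalk x) (g : MvPolynomial (Fin n) k),
    (∀ j, stalkIdeal (W j) x = Ideal.span {w j}) ∧
    Ideal.span (Set.range w) = IsLocalRing.maximalIdeal (F.presheaf.stalk x) ∧
    ringKrullDim (F.presheaf.stalk x) = (n : WithBot ℕ∞) ∧
    LocalNDWon g ∧
    stalkIdeal (AlgebraicGeometry.Scheme.IdealSheafData.vanishingIdeal (⟨closure T, isClosed_closure⟩ : TopologicalSpace.Closeds F)) x = Ideal.span {MvPolynomial.eval₂ (baseToStalk n k ρ x) w g}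

theorem isFrameAt_of_isNDFrameAt {F : AlgebraicGeometry.Scheme.{0}} {ρ : F ⟶ (Literature.AlgebraicGeometry.Motives.projectiveSpace n k).left} {T : Set F} {W : Fin n → F.IdealSheafData} {x : F}
    (h : IsNDFrameAt n k ρ T W x) : IsFrameAt W x := by
  obtain ⟨w, g, h1, h2, h3, -, -⟩ := h
  exact ⟨w, h1, h2, h3⟩

/-- **THE CANDIDATE DOWNSTAIRS INVARIANT `NDInv m F ρ T`** (see the section docstring). [OURS · L1 W4.5b · candidate; parametric use through §13.9] -/
def NDInv (m : ℕ) (F : AlgebraicGeometry.Scheme.{0}) (ρ : F ⟶ (Literature.AlgebraicGeometry.Motives.projectiveSpace n k).left) (T : Set F) : Prop :=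
  Literature.AlgebraicGeometry.Resolution.Scheme.IsRegular F ∧
  ∃ S : Finset F, S.card = m ∧
    (∀ z : ↥(AlgebraicGeometry.Scheme.IdealSheafData.vanishingIdeal (⟨closure T, isClosed_closure⟩ : TopologicalSpace.Closeds F)).subscheme, IsRegularLocalRing ((AlgebraicGeometry.Scheme.IdealSheafData.vanishingIdeal (⟨closure T, isClosed_closure⟩ : TopologicalSpace.Closeds F)).subscheme.presheaf.stalk z) ↔ ((AlgebraicGeometry.Scheme.IdealSheafData.vanishingIdeal (⟨closure T, isClosed_closure⟩ : TopologicalSpace.Closeds F)).subschemeι z : F) ∉ S) ∧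
    (∀ x ∈ S, (∃ z : ↥(AlgebraicGeometry.Scheme.IdealSheafData.vanishingIdeal (⟨closure T, isClosed_closure⟩ : TopologicalSpace.Closeds F)).subscheme, ((AlgebraicGeometry.Scheme.IdealSheafData.vanishingIdeal (⟨closure T, isClosed_closure⟩ : TopologicalSpace.Closeds F)).subschemeι z : F) = x) ∧ IsClosed ({x} : Set F) ∧
      ∃ W : Fin n → F.IdealSheafData, IsNDFrameAt n k ρ T W x)

/-- **(B4-end) PROVED**: at measure `0` the reduced closure of `T` is regular. [OURS · L1 W4.5b] -/
theorem ndInv_end (F : AlgebraicGeometry.Scheme.{0}) (ρ : F ⟶ (Literature.AlgebraicGeometry.Motives.projectiveSpace n k).left) (T : Set F) (h : NDInv n k 0 F ρ T) :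
    Literature.AlgebraicGeometry.Resolution.Scheme.IsRegular (AlgebraicGeometry.Scheme.IdealSheafData.vanishingIdeal (⟨closure T, isClosed_closure⟩ : TopologicalSpace.Closeds F)).subscheme := by
  obtain ⟨-, S, hS, hreg, -⟩ := h
  have hS' : S = ∅ := Finset.card_eq_zero.mp hS
  intro z
  exact (hreg z).mpr (by simp [hS'])

end NDInvariant

/-! ## 13.12 (B4-round) SPLIT (desk R31/DEAL «ND-K5» (β): «idea-1 types the split as sorried sub-signatures with the composition PROVED»):
(B4α′) `RoundAtNDFrame` — THE TORIC HEART at one ND frame: after any blow-up of the closed point `x` carrying local ND frame data `(W, g)`, a strata tower from the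
stepped frame boundary EXISTS, with regular top floor, closed strict-transform set, END (the reduced closure regular over `x`), ISO off `x`, and exact bookkeeping of
`T` off `x` (inside: (B4α) the standard tower over `𝔸ⁿ_k` along the won play of `g` — lead-2's ND dictionary `e1_along_play` / `not_bad_coordinateFace` /
`end_order_one_of_wonPlay` + companion §12.16 — and (B4β) its étale transport along the frame chart `t ↦ w`, `IsBlowup.of_isPullback_of_flat`, `StrictTransformBaseChange`);
(B4β′) `NDInvPersists` — BOOKKEEPING: such a tower takes `NDInv (m+1)` to `NDInv m` (the other non-regular points and their ND frame data move along the isomorphism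
off `x`; no new non-regular point over `x`).  `ndInv_round_of : RoundAtNDFrame → NDInvPersists → RoundFacts n k (NDInv n k)` is PROVED. -/

section RoundSplit

variable (n : ℕ) (k : Type) [Field k]

/-- **(B4α′) as a Prop**: the local round at an ND frame (see the section docstring). [OURS · L1 W4.5b · statement] -/
def RoundAtNDFrame : Prop :=
  ∀ (F₁ : AlgebraicGeometry.Scheme.{0}) (ρ : F₁ ⟶ (Literature.AlgebraicGeometry.Motives.projectiveSpace n k).left) (T₁ : Set F₁),
    Literature.AlgebraicGeometry.Resolution.Scheme.IsRegular F₁ → IsClosed T₁ →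
    ∀ (x : F₁) (hx : IsClosed ({x} : Set F₁)) (W : Fin n → F₁.IdealSheafData), IsNDFrameAt n k ρ T₁ W x →
    ∀ (F₂ : AlgebraicGeometry.Scheme.{0}) (υ : F₂ ⟶ F₁),
      Literature.AlgebraicGeometry.Resolution.IsBlowup υ
        (AlgebraicGeometry.Scheme.IdealSheafData.vanishingIdeal (⟨{x}, hx⟩ : TopologicalSpace.Closeds F₁)) →
      ∃ (F₉ : AlgebraicGeometry.Scheme.{0}) (β : F₉ ⟶ F₂) (T₉ : Set F₉),
        StrataTower F₂ ((frameBoundary W).stepAlong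
            (AlgebraicGeometry.Scheme.IdealSheafData.vanishingIdeal (⟨{x}, hx⟩ : TopologicalSpace.Closeds F₁)) 1 υ)
          (closure (υ ⁻¹' (T₁ \ {x}))) F₉ β T₉ ∧
        Literature.AlgebraicGeometry.Resolution.Scheme.IsRegular F₉ ∧ IsClosed T₉ ∧
        (∀ z : ↥(AlgebraicGeometry.Scheme.IdealSheafData.vanishingIdeal (⟨closure T₉, isClosed_closure⟩ : TopologicalSpace.Closeds F₉)).subscheme, ((AlgebraicGeometry.Scheme.IdealSheafData.vanishingIdeal (⟨closure T₉, isClosed_closure⟩ : TopologicalSpace.Closeds F₉)).subschemeι z : F₉) ∈ (β ≫ υ) ⁻¹' {x} →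
          IsRegularLocalRing ((AlgebraicGeometry.Scheme.IdealSheafData.vanishingIdeal (⟨closure T₉, isClosed_closure⟩ : TopologicalSpace.Closeds F₉)).subscheme.presheaf.stalk z)) ∧
        CategoryTheory.IsIso ((β ≫ υ) ∣_ (⟨{x}ᶜ, hx.isOpen_compl⟩ : F₁.Opens)) ∧
        T₉ ∩ (β ≫ υ) ⁻¹' {x}ᶜ = (β ≫ υ) ⁻¹' (T₁ \ {x})

/-- **(B4β′) as a Prop**: persistence of `NDInv` through a round (see the section docstring). [OURS · L1 W4.5b · statement] -/
def NDInvPersists : Prop :=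
  ∀ (m : ℕ) (F₁ : AlgebraicGeometry.Scheme.{0}) (ρ : F₁ ⟶ (Literature.AlgebraicGeometry.Motives.projectiveSpace n k).left) (T₁ : Set F₁), NDInv n k (m + 1) F₁ ρ T₁ →
    ∀ (x : F₁) (hx : IsClosed ({x} : Set F₁)),
      (∃ z : ↥(AlgebraicGeometry.Scheme.IdealSheafData.vanishingIdeal (⟨closure T₁, isClosed_closure⟩ : TopologicalSpace.Closeds F₁)).subscheme, ((AlgebraicGeometry.Scheme.IdealSheafData.vanishingIdeal (⟨closure T₁, isClosed_closure⟩ : TopologicalSpace.Closeds F₁)).subschemeι z : F₁) = x ∧ ¬ IsRegularLocalRing ((AlgebraicGeometry.Scheme.IdealSheafData.vanishingIdeal (⟨closure T₁, isClosed_closure⟩ : TopologicalSpace.Closeds F₁)).subscheme.presheaf.stalk z)) →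
    ∀ (F₂ : AlgebraicGeometry.Scheme.{0}) (υ : F₂ ⟶ F₁),
      Literature.AlgebraicGeometry.Resolution.IsBlowup υ
        (AlgebraicGeometry.Scheme.IdealSheafData.vanishingIdeal (⟨{x}, hx⟩ : TopologicalSpace.Closeds F₁)) →
    ∀ (F₉ : AlgebraicGeometry.Scheme.{0}) (β : F₉ ⟶ F₂) (T₉ : Set F₉),
      Literature.AlgebraicGeometry.Resolution.Scheme.IsRegular F₉ → IsClosed T₉ →
      (∀ z : ↥(AlgebraicGeometry.Scheme.IdealSheafData.vanishingIdeal (⟨closure T₉, isClosed_closure⟩ : TopologicalSpace.Closeds F₉)).subscheme, ((AlgebraicGeometry.Scheme.IdealSheafData.vanishingIdeal (⟨closure T₉, isClosed_closure⟩ : TopologicalSpace.Closeds F₉)).subschemeι z : F₉) ∈ (β ≫ υ) ⁻¹' {x} →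
        IsRegularLocalRing ((AlgebraicGeometry.Scheme.IdealSheafData.vanishingIdeal (⟨closure T₉, isClosed_closure⟩ : TopologicalSpace.Closeds F₉)).subscheme.presheaf.stalk z)) →
      CategoryTheory.IsIso ((β ≫ υ) ∣_ (⟨{x}ᶜ, hx.isOpen_compl⟩ : F₁.Opens)) →
      T₉ ∩ (β ≫ υ) ⁻¹' {x}ᶜ = (β ≫ υ) ⁻¹' (T₁ \ {x}) →
      NDInv n k m F₉ ((β ≫ υ) ≫ ρ) T₉

/-- **THE COMPOSITION, PROVED**: (B4α′) + (B4β′) ⇒ (B4-round).  Needs `IsClosed T₁`, which `NDInv` does not record — so it is taken through the invariant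
`NDInvC m F ρ T := NDInv m F ρ T ∧ IsClosed T`?  No: K5′'s rounds start at `T = range ι` (closed) and every tower returns a CLOSED `T₉` ((B4α′) clause), so we
simply run §13.9 with the closed variant `NDInvC` (below) — `hres_of_rounds` is parametric. [OURS · L1 W4.5b] -/
def NDInvC (m : ℕ) (F : AlgebraicGeometry.Scheme.{0}) (ρ : F ⟶ (Literature.AlgebraicGeometry.Motives.projectiveSpace n k).left) (T : Set F) : Prop :=
  NDInv n k m F ρ T ∧ IsClosed T

theorem ndInvC_end (F : AlgebraicGeometry.Scheme.{0}) (ρ : F ⟶ (Literature.AlgebraicGeometry.Motives.projectiveSpace n k).left) (T : Set F) (h : NDInvC n k 0 F ρ T) :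
    Literature.AlgebraicGeometry.Resolution.Scheme.IsRegular (AlgebraicGeometry.Scheme.IdealSheafData.vanishingIdeal (⟨closure T, isClosed_closure⟩ : TopologicalSpace.Closeds F)).subscheme :=
  ndInv_end n k F ρ T h.1

theorem ndInv_round_of (hα : RoundAtNDFrame n k) (hβ : NDInvPersists n k) : RoundFacts n k (NDInvC n k) := by
  intro m F₁ ρ T₁ h
  obtain ⟨⟨hreg, S, hcard, hiff, hS⟩, hT₁⟩ := h
  obtain ⟨x, hxS⟩ := Finset.card_pos.mp (by omega : 0 < S.card)
  obtain ⟨⟨z, hz⟩, hxcl, W, hW⟩ := hS x hxS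
  subst hz
  have hnreg : ¬ IsRegularLocalRing ((AlgebraicGeometry.Scheme.IdealSheafData.vanishingIdeal (⟨closure T₁, isClosed_closure⟩ : TopologicalSpace.Closeds F₁)).subscheme.presheaf.stalk z) := fun hr => (hiff z).mp hr hxS
  refine ⟨z, hxcl, hnreg, hreg _, fun F₂ υ hυ => ?_⟩
  obtain ⟨F₉, β, T₉, htower, hreg₉, hT₉, hend, hiso, hbook⟩ := hα F₁ ρ T₁ hreg hT₁ _ hxcl W hW F₂ υ hυ
  refine ⟨F₉, β, T₉, ⟨hxcl, W, isFrameAt_of_isNDFrameAt n k hW, htower⟩, m, le_refl m, ?_, hT₉⟩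
  exact hβ m F₁ ρ T₁ ⟨hreg, S, hcard, hiff, hS⟩ _ hxcl ⟨z, rfl, hnreg⟩ F₂ υ hυ F₉ β T₉ hreg₉ hT₉ hend hiso hbook

end RoundSplit

end Summit.ResolutionOfSingularities.ResolutionOfSingularities.Cruxes.EquisingularLiftNat.Sections.ND

end
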